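import Mathlib
import HarnessLib
import HarnessLib.Audit
import Summits.HodgeConjecture.Statement
import Literature.AlgebraicGeometry.Motives.FamiliesVHS
import Literature.AlgebraicGeometry.Motives.Lefschetz
import Literature.AlgebraicGeometry.Motives.AbelianVariety
import HarnessLib.Audit.Status.Attr

/-!
Route: ConservativityLefschetz

# Route ConservativityLefschetz — B for compact abelian pencils — to be got from Chow–Künneth +
Ayoub conservativity (hard Lefschetz becomes invertible) — gives HC for all abelian varieties

Card conservativity-chow-kunneth-weil-bridge. The typed route is an UNCONDITIONAL reduction
(André/Tankeev); its intended
engine is CONDITIONAL on Ayoub's conservativity conjecture Cons (Ayoub2007; Ayoub2017Conjectures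
Conj. 2.1: the Betti
realisation of Voevodsky motives DM_gm(ℂ)_ℚ ⊃ CHM(ℂ)_ℚ reflects isomorphisms), which is not yet a
named fact of the tree
(cite request filed; the header flag `conditional_bridge` stays false until the decl exists). It
suffices to show
X = AbelianPencilLefschetzB: Grothendieck's standard conjecture B (θ-form, Kleiman) for
every total space Y of a compact pencil of abelian varieties f : Y → C (an abelian scheme with
section over a smooth
projective complex curve, Y smooth projective), for the classical (summit-compatible) Betti–Hodge
datum. The route's way to
X is the two informal rank-2/3 cruxes filed at open: ConservativityChow (the fragment of Cons for
Chow motives in the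
tensor subcategory generated by h(Y)) and ChowKunnethAbelianPencils (Murre's Chow–Künneth
decomposition of h(Y), refining
Deninger–Murre's relative one), glued by the Cayley–Hamilton lemma "CK(Y) ∧ Cons ⇒ B(Y)": f_i :=
p_{2n−i} ∘ L^{n−i} ∘ p_i is
a morphism of Chow motives whose realisation is the hard-Lefschetz isomorphism, so Cons inverts it
and the inverse
correspondence is Kleiman's θ. André's Théorème 0.6.2 (sharp form) + §0.3 + Kleiman's product
stability + Lieberman turn X
into the B-relative Hodge conjecture for every complex abelian variety (AndreAbelianReduction); the
classical datum
(ClassicalBettiDatum) transports it to the summit layer; the remainder of the summit (HC off abelian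
varieties) is the
explicitly NOT-claimed item AbelianComplement. The cohomological shadow of the Chow–Künneth crux,
the Künneth standard
conjecture C(Y) for the same Y, is filed as the typed early-warning crux AbelianPencilKunnethC.
Lean: `open Literature.AlgebraicGeometry.Motives Literature.AlgebraicGeometry.HodgeTheory
Literature.AlgebraicTopology.SingularHomology CategoryTheory in ∀ B : BettiHodgeData ℂ, (∀ ⦃n : ℕ⦄
⦃X : SchemeOver ℂ⦄ (hX : IsSmoothProjective n X) (p : ℕ), (∀ (t : B.W.obj X (2 * p)) (ζ :
singularCochainComplex.cocycles ℚ ℚ (ComplexPoints X) (2 * p)) (z : singularCochainComplex.cocycles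
ℂ ℂ (ComplexPoints X) (2 * p)), singularCohomology.π ℚ ℚ (ComplexPoints X) (2 * p) ζ = B.isoObj X (2
* p) t → (∀ σ : SingularSimplex (ComplexPoints X) (2 * p), (singularCochainComplex.iCocycles ℂ ℂ
(ComplexPoints X) (2 * p) z) σ = (((singularCochainComplex.iCocycles ℚ ℚ (ComplexPoints X) (2 * p)
ζ) σ : ℚ) : ℂ)) → (t ∈ (B.hodge hX (2 * p)).hodgeClasses (p : ℤ) ↔ IsOfHodgeType n X (2 * p) p p
(singularCohomology.π ℂ ℂ (ComplexPoints X) (2 * p) z))) ∧ Submodule.span ℂ {c | ∃ t ∈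
B.W.algebraicClasses X p, ∃ (ζ : singularCochainComplex.cocycles ℚ ℚ (ComplexPoints X) (2 * p)) (z :
singularCochainComplex.cocycles ℂ ℂ (ComplexPoints X) (2 * p)), singularCohomology.π ℚ ℚ
(ComplexPoints X) (2 * p) ζ = B.isoObj X (2 * p) t ∧ (∀ σ : SingularSimplex (ComplexPoints X) (2 *
p), (singularCochainComplex.iCocycles ℂ ℂ (ComplexPoints X) (2 * p) z) σ =
(((singularCochainComplex.iCocycles ℚ ℚ (ComplexPoints X) (2 * p) ζ) σ : ℚ) : ℂ)) ∧ c =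
singularCohomology.π ℂ ℂ (ComplexPoints X) (2 * p) z} = algebraicClasses X p ∧ Nonempty (HodgeModel
n X)) → ∀ ⦃d : ℕ⦄ ⦃C Y : SchemeOver ℂ⦄ (f : Y ⟶ C) (e : C ⟶ Y), e ≫ f = 𝟙 C → IsSmoothProjective 1 C
→ IsSmoothProjective (d + 1) Y → IsSmoothProjectiveFamily f d → (∀ s : AlgPoints C ℂ, ∃ A :
AbelianVariety ℂ, Nonempty (A.X ≅ fiberOver f s)) → ∀ η : B.W.obj Y 2, B.W.IsHyperplaneClass Y η → ∀
(i r j : ℕ), i + r = d + 1 → ∀ h₂ : i + 2 * r = j, ∃ θ : B.W.obj Y j →ₗ[ℚ] B.W.obj Y i,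
B.W.IsLefschetzTheta (d + 1) η r h₂ θ ∧ B.W.IsAlgebraicOperator (d + 1) (d + 1) θ`
(rev 2, cone repair: this is VERBATIM `∀ B, B.IsSummitCompatible → … → B.W.StandardConjectureB (d +
1) Y η` with the guard `BettiHodgeData.IsSummitCompatible` inlined — `cocycleOfRat ζ` replaced by
its defining property `∀ σ, z σ = ↑(ζ σ)` — and Kleiman's θ-form `StandardConjectureB` unfolded
(`Iff.rfl`), so that the route file imports only fact-free modules (FamiliesVHS, Lefschetz,
AbelianVariety); the equivalences are certified sorry-free in the planner's EquivTest.lean, attached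
as item evidence.)

## Assembly
Few lines of logic (glue.lean, `theorem closes`, elaborated rc 0 in Sketch2.lean): take B, its
summit-compatibility guard and its summit transfer from ClassicalBettiDatum (rev 2: the transfer `(∀
p, B.HodgeConjectureFor hX p) → HodgeTheory.HodgeConjectureFor n X` — the tree theorem
`BettiHodgeData.IsSummitCompatible.hodgeConjectureFor` — is a conjunct of that CONSTRUCTION item
instead of a glue import); AbelianPencilLefschetzB at B discharges the hypothesis of
AndreAbelianReduction, giving `B.HodgeConjectureFor hA p` for every abelian variety A with `hA :
IsSmoothProjective A.dim A.X` and every p; the transfer turns this into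
`HodgeTheory.HodgeConjectureFor A.dim A.X`; AbelianComplement (whose hypothesis now carries `hA`
explicitly — every abelian variety has it, tree theorem `AbelianVariety.isSmoothProjective_holds`,
used by its prover, not by the route file) returns `HodgeConjecture`. AbelianPencilKunnethC is a
shadow crux (early warning), not in the chain. The informal cruxes ConservativityChow,
ChowKunnethAbelianPencils and the glue CayleyHamiltonLefschetz (filed at open, typed once the
Chow-motive definitions land) are the route's intended proof of AbelianPencilLefschetzB: a foreseen
glued split.

Rationale: WHY THIS LINE. André reduced the Hodge conjecture for ALL complex abelian varieties (Weil classes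
included) to the algebraicity of the
Lefschetz involution on products A × B × Y₁ × ⋯ × Y_k, Y_j total spaces of compact pencils of
abelian varieties
(Andre1996Motifs Thm 0.6.2, §6.3 Rem. 2; tree barrier
Andre1996_hodgeClassesOnAbelianVarieties_motivated read as an
invitation), and Tankeev2003 sharpened the residual to one algebraic isomorphism H²(C, R^{2d−i}f_*ℚ)
⥲ H⁰(C, R^i f_*ℚ);
B(Y) is known only when the generic Hodge group is large (End = ℤ, non-exceptional d: Tankeev2003),
for d ≤ 2
(Tankeev2011: all threefolds with κ < 3) and for d = 3 with degenerations (Tankeev2021, Tankeev2024)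
— never for the
Mumford–Tate pencils of Weil/CM type that carry the open classes. The import is from the motivic
(triangulated-category)
side: conservativity (Ayoub2007, Bondarko2018Conservativity — whose recorded consequences are
Kimura-finiteness of
numerical motives and zeta rationality, not B) says an inverse EXISTS as soon as the realisation is
invertible, so the
θ-half of B(Y) costs nothing and the unconditional work becomes an idempotent problem — absolute
Chow–Künneth for a
1-parameter abelian family (Murre1993; relative technology DeningerMurre1991, Kunnemann1993,
GordonHanamuraMurre2003,
GordonHanamuraMurre2005; Lefschetz-class projectors Milne1999LefschetzClasses; symmetrically
distinguished lifts
OSullivan2011) — instead of a cycle construction. What prior lines do not do: card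
lefschetz-b-abelian-pencils-localisation
attacks B(pencil) directly by relative Fourier and stalls at lifting the invariant class (VHC);
routes
MomentAmplification / PeriodsPolice want B for ALL X as a shared node; no route or searched paper
derives B from Cons.
Honest leverage caveat (auditor r19 and our own analysis, see Cheapest falsifier): for a Weil-type
pencil the
Chow–Künneth projector onto h⁰(C, R^{2m}) has cohomology class (i_t × id)_*τ'_t, the push-forward of
the transport class
τ'_t = Σ w_a^∨ ⊠ w̃_a on A_t × Y (a Weil-type Hodge class on A_t × A_s off s = t, a Lefschetz class
at s = t), so the CK
crux contains an exceptional-class problem of its own; the bet is that this pushed-forward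
idempotent class and its
rational-equivalence lift are more accessible than the Weil cycles (as idempotents were for modular
families), and the
typed crux AbelianPencilKunnethC is there to test exactly that cheaply.

RANKED CRUXES. #4 AbelianPencilLefschetzB (crux) — X itself (card P1's output): for every
summit-compatible Betti–Hodge datum B and every compact pencil of abelian varieties f : Y → C with
section (C a smooth projective curve, Y smooth projective of dimension d+1, f smooth proper of
relative dimension d, all rational fibres abelian varieties), B(Y) holds in θ-form for every
hyperplane class η: the inverse of L^{d+1−i} : Hⁱ(Y) → H^{2d+2−i}(Y) is an algebraic operator. The
node that ConservativityChow ∧ ChowKunnethAbelianPencils (informal, ranks 2–3) prove via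
CayleyHamiltonLefschetz; also attackable directly (Tankeev's criterion). [difficulty: open-problem]
(why it might fail: Open exactly for the Mumford–Tate pencils of Weil/CM type (d ≥ 4, good reduction
everywhere) where B(Y) ⇒ HC(Weil) (André Rem. 2, Tankeev2003); known only for End_gen = ℤ
non-exceptional d, d ≤ 2, d = 3 with degenerations; an exotic guarded B could also falsify the ∀B
form.) [Tankeev2003, Tankeev2011, Tankeev2024, Andre1996Motifs, Kleiman1968, Ayoub2017Conjectures]
#5 AbelianPencilKunnethC (crux) — the Künneth standard conjecture C(Y) (Kleiman) for the same total
spaces Y and every summit-compatible B: every Künneth projector of Y is an algebraic operator. It is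
the cohomological shadow of the informal crux ChowKunnethAbelianPencils (CK(Y) ⇒ C(Y)) and is
implied by AbelianPencilLefschetzB (B ⇒ C); with Deninger–Murre's relative projectors it isolates
the projector P_{0,j} onto the Leray piece H⁰(C, R^j f_*ℚ), the first place an exceptional class can
appear — the route's early-warning item. [difficulty: L] (why it might fail: For a Weil-type pencil,
π_{2m} ∘ p^{rel}_{2m} is the projector onto H⁰(C,R^{2m}) with class (i_t×id)_*(Σ w_a^∨ ⊠ w̃_a), an
exceptional Hodge class on Y×Y built from Weil classes — not known algebraic for d ≥ 3 (known:
divisor-spanned invariants, End_gen = ℤ).) [Kleiman1968, DeningerMurre1991, Tankeev2003,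
Milne1999LefschetzClasses, Murre2004LecturesMotives]
#9 AndreAbelianReduction (support) — André's Remarque 2 in typed form, at any summit-compatible
datum B: if B(Y) (θ-form, all hyperplane classes) holds for every compact pencil of abelian
varieties with section as above, then the B-relative Hodge conjecture ℚ·Aᵖ(A) = Hdgᵖ(A) holds for
every complex abelian variety A and every p. Printed proof: Andre1996Motifs Thm 0.6.2 (every Hodge
class on A is p_*(α ∪ ⋆_L β) with α, β algebraic on A × B × Y₁ × ⋯ × Y_k, Y_j pencils from Lemme
6.3.1, which are abelian schemes with zero section over complete curves) + §0.3 (motivated =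
algebraic once ⋆_L is algebraic) + B stable under products (Kleiman1968 §2) + B for abelian
varieties (Lieberman; tree fact standardConjectureB_abelianVariety). A theorem in print at the
classical datum; XL to formalise (Mumford–Tate families, theorem of the fixed part). [difficulty:
XL] [Andre1996Motifs, Kleiman1968, Tankeev2003, Deligne2000]
#9 ClassicalBettiDatum (support) — CONSTRUCTION (interface/instance separation): there is a
Betti–Hodge datum B : BettiHodgeData ℂ — singular cohomology of X(ℂ) with ℚ-coefficients as a Weil
cohomology, the Hodge–Deligne Hodge structures, the topological cycle class — that is
summit-compatible (its Hodge classes are the rational (p,p)-classes, its algebraic classes span Nᵖ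
H²ᵖ(X(ℂ);ℂ), Hodge models exist; `BettiHodgeData.IsSummitCompatible`). Shared in substance with
MomentAmplification's BettiBridge and PeriodsPolice's ClassicalBridge (minimal form here).
[difficulty: XL] [Deligne2000, VoisinHodgeI2002, Kleiman1968, Fulton1998]
#9 AbelianComplement (support) — NOT CLAIMED BY THIS ROUTE — the remainder of the summit: the Hodge
conjecture for all smooth projective complex varieties GIVEN the (summit-layer) Hodge conjecture for
every complex abelian variety. Present only so that the deciding theorem reaches `HodgeConjecture`
(D-0027); under this line's own philosophy it would further reduce, CONDITIONALLY on Cons, to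
Murre's Chow–Künneth conjecture for all X plus "Hodge classes are motivated" (André Thm 0.4) — see
Two-layer plan. Any route proving the summit outright supersedes it. Do not staff. [difficulty:
open-problem] [Deligne2000, Andre1996Motifs]

TWO-LAYER PLAN. Foreseen glued splits (filed only when the definitions land / a crux closes):
AbelianPencilLefschetzB ⇐ ConservativityChow →
ChowKunnethAbelianPencils → AbelianPencilLefschetzB (glue = CayleyHamiltonLefschetz: for Y with a
Chow–Künneth
decomposition, f_i := p_{2n−i} ∘ L^{n−i} ∘ p_i realises to the hard-Lefschetz iso, Cons on ⟨h(Y)⟩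
inverts it in DM_gm,
Voevodsky2000 full faithfulness puts the inverse in CHM, Kleiman's θ-form follows).
ChowKunnethAbelianPencils ⇐
RelativeProjectors (Deninger–Murre/Künnemann + Lefschetz-class projector onto generic-monodromy
invariants, O'Sullivan lifts)
→ LeraySplitting (h⁰/h¹/h² of the invariant part: the transport-class item) →
ChowKunnethAbelianPencils. AbelianComplement,
if ever staffed under this philosophy: ⇐ ChowKunnethAllX (Murre (A)) → HodgeClassesMotivated (André
Thm 0.4 layer, shared
with MomentAmplification/PeriodsPolice) → AbelianComplement, again conditional on Cons.

KILL CRITERIA. (i) A refutation of AbelianPencilKunnethC or AbelianPencilLefschetzB at the classical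
datum is a disproof of C/B and,
via André, essentially of HC for abelian varieties — celebrate, close `refuted:` and hand the
witness to the negative
side. (ii) If a refuter PROVES that CK(Y) (or already C(Y)) for Weil-type pencils is EQUIVALENT to
the algebraicity of the
Weil classes on the fibres A_t × A_s (i.e. the idempotent problem is the cycle problem), the bridge
buys nothing over
card lefschetz-b-abelian-pencils-localisation: close `superseded`/known-reduction and record the
equivalence as a
Literature note. (iii) If ConservativityChow is shown to need the full DM_gm statement whose
announced proof failed
(Bondarko2018Conservativity Rem. 5.4) with no weaker fragment sufficing, the route stays open but
dormant (pure
conditional bridge). (iv) If ClassicalBettiDatum is refuted because singular cohomology cannot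
instantiate the tree's
C-lite axioms literally, or an exotic summit-compatible B falsifies the ∀B-cruxes, re-base the guard
(shared fix with
MomentAmplification's LefschetzB), do not celebrate. (v) B(Y) for all abelian schemes over curves
proved elsewhere
(Tankeev's programme) moots the Cons mechanism and closes the abelian-variety case of HC outright
through
AndreAbelianReduction.

NOT DECOMPOSED YET. No typed Chow-level items: the tree has Chow groups (`Motives.ChowGroup`) and
the action of correspondences as a
hypothesis structure (`CorrespondenceChowAction`) but no intersection product, hence no composition
of correspondences
modulo rational equivalence, no CHM/DM_gm and no realisation functor — ConservativityChow,
ChowKunnethAbelianPencils and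
CayleyHamiltonLefschetz are filed informal with definition requests and get signatures by
`set-signature` when the
notions land. No item for Murre's conjecture for all X, for "Hodge ⇒ motivated", or for the products
A × B × ΠY_j (product
stability of B and Lieberman are inside AndreAbelianReduction's printed proof). No restriction of
the pencil class to
Mumford–Tate/Weil-type families (B is expected for all of them; the open ones are named in the
why-lines). No variant
with motivated classes modelled on André's auxiliary class 𝒱 (definition request filed instead).

CHEAPEST FALSIFIER. Pen-and-paper, one afternoon, for a refuter: take a Weil-type pencil f : Y → C
(K imaginary quadratic, d = 2n ≥ 4) and
write the cohomology class of the would-be Chow–Künneth projector onto h⁰(C, R^{2n}f_*ℚ)|_Weil: it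
is (i_t × id)_*τ'_t
with τ'_t = Σ_a w_{a,t}^∨ ⊠ w̃_a ∈ H(A_t × Y), a flat Hodge class algebraic at the fibre s = t
(Lefschetz class,
Milne1999LefschetzClasses). Decide whether algebraicity of this PUSHED-FORWARD class already forces
algebraicity of the
Weil classes w_{a,t} (then kill criterion (ii) fires and the route is a relabelling of VHC), or
whether it is strictly
weaker (then the bet stands). Literature lookup running in parallel: Tankeev2003 §§9–11 (acq-02656,
paywalled) may
already contain this computation.

NUMBERS. Known cases of B(Y) for abelian schemes Y → C over smooth projective complex curves:
End(generic geometric fibre) = ℤ and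
d non-exceptional, e.g. d odd (Tankeev2003); d ≤ 2 (Tankeev2011: every smooth projective threefold
with κ < 3); d = 3
with a semistable bad fibre, all endomorphism types (Tankeev2021, Tankeev2024 — Néron-model
compactifications, so not
the compact case). Open: d ≥ 4 with generic Hodge group of Weil/CM type, good reduction everywhere —
André's pencils.
HC for Weil classes themselves: abelian fourfolds done (Markman2025SecantWeil), sixfolds partly
(arXiv:2603.20268).
Items at open: 6 typed (2 crux, 3 support, 1 assembly) + 3 informal filed right after open (2 crux,
1 support) = 9.

DEFINITION REQUESTS. (1) `ChowCorrespondence` calculus: composition of correspondences modulo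
rational equivalence on smooth projective
k-varieties (Fulton 16.1) with the cycle-class ring homomorphism to
`PreWeilCohomology.IsAlgebraicGradedOp` operators —
equivalently the category CHM(k)_ℚ of Chow motives with its realisation to a Weil cohomology
(interface + separate
construction statement); needed to type ChowKunnethAbelianPencils, CayleyHamiltonLefschetz and the
CHM-fragment of
ConservativityChow (topic Literature/AlgebraicGeometry/Motives). (2) `BettiRealisationConservative`
: the conservativity
predicate for a realisation functor on DM_gm(ℂ)_ℚ or on CHM(ℂ)_ℚ (Ayoub2017Conjectures Conj. 2.1) as
a NAMED FACT
(cite item, family hodge). (3) `motivatedClassesModelledOn 𝒱` : André's Déf. 1 with a restricted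
auxiliary class 𝒱 and
the sharp Thm 0.6.2 predicate (Hodge classes on abelian varieties are motivated modelled on 𝒱_ab =
abelian varieties ×
compact abelian pencils), so that AndreAbelianReduction can later be split along the printed proof.

Novelty: Searches (2026-08-15): grep of all 40 Theses files of the sub for conservativ/Künneth/Chow–Künneth
(0 routes use Cons or
CK; LefschetzB-for-all-X appears in MomentAmplification, PeriodsPolice); `lit search "Tankeev
standard conjecture
Lefschetz type threefolds fibred abelian"` (crossref 18: Tankeev2003/2011/2021/2024 found, zbMATH
reviews read via API);
`lit search --source zbmath "conservativity conjecture realization functor standard conjecture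
Lefschetz type"` (0);
`lit search --source arxiv "conservativity conjecture motives"` (15, none on B/HC); `lit search
--source zbmath
"Chow-Künneth decomposition abelian schemes over curves"` (4: Murre1993, del Angel–Müller-Stach,
irrelevant 2); zbMATH
review of Huber2008 (slice filtration vs HC: uses HC as input, opposite direction); `lit frontier
HodgeConjecture --since
2022` (30 rows; arXiv:2603.20268 Weil sixfolds, nothing motivic-conservativity); `lit bridges
HodgeConjecture --cross any`
(nothing relevant); card's own audit r19 (Ayoub2017Conjectures pp. 11–15 read: consequences Props
2.15–2.27 list Kimura,
not B; Bondarko2018Conservativity read: Kimura-finiteness of Mot_num, zeta rationality).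
Nearest prior art found: Ayoub2017Conjectures Conj. 2.1 / Props 2.22–2.24 (Cons + weak CK ⇒ Kimura —
the template of the
Cayley–Hamilton lemma); Andre1996Motifs §6.3 Rem. 2 and Tankeev2003 (HC(AV) ⇐ B(compact abelian
pencils) ⇐ one algebraic
iso H²(C,R^{2d−i}) ⥲ H⁰(C,R^i)); GordonHanamuraMurre2005 (absolute CK for modular abelian fibration  [refs: 2603.20268, Tankeev2003, Murre1993, Huber2008, GordonHanamuraMurre2005]

Barriers (technique_class: conditional-bridge, conservativity, chow-kunneth): - technique_class: conditional-bridge, conservativity, chow-kunneth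
- Literature.Barriers.HodgeConjecture.Andre1996_hodgeClassesOnAbelianVarieties_motivated: used
positively — it is the route's AndreAbelianReduction (the barrier's own evasions_known: "prove the
algebraicity of ⋆_L on compact pencils of abelian varieties"); the line supplies ⋆_L by Cons +
Chow–Künneth instead of geometry.
- Literature.Barriers.HodgeConjecture.Weil1977_exceptionalHodgeClasses: evaded in statement (no
claim that Hodge classes are divisor polynomials; Weil classes become algebraic through ⋆_L on
auxiliary pencils) but NOT in substance for the CK crux: the h⁰-projector of a Weil-type pencil is
itself an exceptional class on Y × Y — stated openly (AbelianPencilKunnethC why-line, kill criterion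
ii); the bet is that the pushed-forward idempotent class is weaker than the Weil cycles.
- Literature.Barriers.HodgeConjecture.Mumford1968_simpleFourfold_exceptionalHodgeClasses: same as
the previous line; simplicity of the fibre plays no role.
- Literature.Barriers.HodgeConjecture.Clemens1983_griffithsGroup_infiniteRank: no finiteness of
cycle groups and no Abel–Jacobi argument; Chow motives enter only through idempotents and hard
Lefschetz with ℚ-coefficients.
- Literature.Barriers.HodgeConjecture.Zucker1977_kaehlerTorus_noAnalyticCycles: motives,
correspondences and Cons exist only for algebraic varieties; every Y here is projective —
consistent.
- Literature.Barriers.HodgeConjecture.Voisin2002_weilTorus_h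

Novelty grade: new-combination — ROUTE REVIEW (refuter rreview-0815T14-4). new-combination: André 1996 Thm 0.6.2 + §6.3 Rem. 2 (HC(AV) ⇐ B(Y) for compact abelian pencils; Tankeev2003 sharpening) joined with Ayoub's conservativity (Ayoub2007; 2017 Conj. 2.1) through a Chow–Künneth 'Cayley–Hamilton' lemma templated on Ayoub2017 Props (refuter refuter-rreview-0815T14-4-0, 2026-08-15T15:02:33Z; prior: Andre1996Motifs, Tankeev2003, Ayoub2017Conjectures, Bondarko2018Conservativity, GordonHanamuraMurre2005)

History (route lifecycle, newest last):
- 2026-08-15T16:16:02Z · rev 2: restated AbelianPencilLefschetzB (stmt-HodgeConjecture-9722), AbelianPencilKunnethC (stmt-HodgeConjecture-9723), AndreAbelianReduction (stmt-HodgeConjecture-9724), ClassicalBettiDatum (stmt-HodgeConjecture-9725), AbelianComplement (stmt-HodgeConjecture-9726) — cone repair (rrepair g2): re-routed around all 20 un (planner-rrepair-HodgeConjecture-Conservativity-a269f9da-g2-0)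

sub-problem: HodgeConjecture · status: done · opened planner-plancard-HodgeConjecture-HodgeConject-f02e0b06-0 2026-08-15T14:16:03Z · rev 2 · ledger route-HodgeConjecture-ConservativityLefschetz
GENERATED by the gate from the ledger (D-0016/17). Provers cite these decls: `theorem foo : Summit.HodgeConjecture.HodgeConjecture.Theses.ConservativityLefschetz.<Decl> := …` in Summits/HodgeConjecture/HodgeConjecture/Theorems/<Name>.lean.
-/

namespace Summit.HodgeConjecture.HodgeConjecture.Theses.ConservativityLefschetz

open scoped BigOperators Topology Manifold Classical MeasureTheory ProbabilityTheory Matrix InnerProductSpace ComplexConjugate ContinuousMap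
open Filter Set Function TopologicalSpace MeasureTheory

attribute [summit_statement] _root_.HodgeConjecture

-- item stmt-HodgeConjecture-9775 · crux · rank 2 · open · by planner — informal only, no Lean statement yet:
--   [crux] CONSERVATIVITY, the load-bearing CONDITION of the line (Ayoub's conservation/conservativity
--   conjecture, Ayoub2007; Ayoub2017Conjectures Conj. 2.1), in the fragment the route consumes: for
--   smooth projective complex varieties X, Y, idempotent correspondences p ∈ CH^{dim X}(X×X)_ℚ, q ∈
--   CH^{dim Y}(Y×Y)_ℚ (idempotent under composition modulo RATIONAL equivalence) and a morphism of Chow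
--   motives f : (X,p,m) → (Y,q,n) in CHM(ℂ)_ℚ (f ∈ q ∘ CH^*(X×Y)_ℚ ∘ p): if the Betti realisation H_B(f)
--   : p_*H^*(X,ℚ) → q_*H^*(Y,ℚ) (with twists) is an ISOMORPHISM, then f is invertible in CHM(ℂ)_ℚ —
--   there is g ∈

-- item stmt-HodgeConjecture-9777 · crux · rank 3 · open · by planner — informal only, no Lean statement yet:
--   [crux] CHOW–KÜNNETH FOR COMPACT ABELIAN PENCILS (card K1; Murre1993 Conjecture (A) for this class):
--   for every abelian scheme f : Y → C with projective total space over a smooth projective complex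
--   curve (the class of items AbelianPencilLefschetzB / AbelianPencilKunnethC: section e, f smooth
--   proper of relative dimension d, fibres abelian varieties), the Chow motive h(Y) ∈ CHM(ℂ)_ℚ has a
--   Chow–Künneth decomposition: mutually orthogonal idempotents π_0, …, π_{2d+2} ∈ CH^{d+1}(Y×Y)_ℚ
--   (modulo RATIONAL equivalence) summing to Δ_Y whose Betti realisations are the Künneth projectors
--   H^*(Y) → H^i(Y). Int

-- earlier AbelianPencilLefschetzB (stmt-HodgeConjecture-9722, replaced 2026-08-15T16:16:02Z -> stmt-HodgeConjecture-10448): retired by None — open Literature.AlgebraicGeometry.Motives CategoryTheory in ∀ B : BettiHodgeData ℂ, B.IsSummitCompatible → ∀ ⦃d : ℕ⦄ ⦃C Y : SchemeOver ℂ⦄ (f : Y ⟶ C) (e : C ⟶ Y), e ≫ f = 𝟙 C → IsSmoothProjective 1 C → IsSmoothProjective (d + 1) Y → IsSmoothProjectiveFamily f 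
/-- item stmt-HodgeConjecture-10448 · crux · rank 4 · open · by planner
why it might fail: At the classical datum: equivalent to HC for ALL complex abelian varieties (Tankeev2008 ⟸, André Rem.2/Tankeev2003 ⟹), open beyond fourfolds; B(Y) known only for Hg(generic fibre) of restricted type (End=ℤ, d non-exceptional), d≤2, d=3 Néron models; an exotic summit-compatible B may break ∀B
sources: Tankeev2003, Tankeev2008, Tankeev2011, Tankeev2021, Tankeev2024, Andre1996Motifs
[crux] X itself (card P1's output): for every summit-compatible Betti–Hodge datum B (guard =
`BettiHodgeData.IsSummitCompatible` written out over fact-free modules: (a) t ∈ H²ᵖ_B(X) is B-Hodge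
iff [ζ ⊗ 1] is a rational (p,p)-class whenever [ζ] = isoObj t, the complexified cocycle z = ζ ⊗ 1
being described by ∀ σ, z σ = ↑(ζ σ) instead of `cocycleOfRat`; (b) complexified B-algebraic classes
span Nᵖ H²ᵖ(X(ℂ);ℂ); (c) Hodge models exist — equivalent to `B.IsSummitCompatible` by
`iCocycles_cocycleOfRat`, certified in evidence EquivTest.lean `guard_iff`) and every compact pencil
of abelian varieties f : Y → C with section (C a smooth projective curve, Y smooth projective of
dimension d+1, f smooth proper of relative dimension d, all rational fibres abelian varieties), B(Y)
holds in θ-form for every hyperplane class η: for i + r = d+1 there is θ : H^{i+2r}(Y) → Hⁱ(Y),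
two-sided inverse of L^r, which is an algebraic operator — VERBATIM `B.W.StandardConjectureB (d + 1)
Y η` unfolded (Kleiman θ-form; `Iff.rfl`, so a prover may `exact` a proof of the named predicate).
The node that ConservativityChow ∧ ChowKunnethAbelianPencils (informal, ranks 2–3) prove via
CayleyHamiltonLefschetz; also atta -/
@[route_item "route-HodgeConjecture-ConservativityLefschetz", crux]
def AbelianPencilLefschetzB : Prop :=
  open Literature.AlgebraicGeometry.Motives Literature.AlgebraicGeometry.HodgeTheory Literature.AlgebraicTopology.SingularHomology CategoryTheory in ∀ B : BettiHodgeData ℂ, (∀ ⦃n : ℕ⦄ ⦃X : SchemeOver ℂ⦄ (hX : IsSmoothProjective n X) (p : ℕ), (∀ (t : B.W.obj X (2 * p)) (ζ : singularCochainComplex.cocycles ℚ ℚ (ComplexPoints X) (2 * p)) (z : singularCochainComplex.cocycles ℂ ℂ (ComplexPoints X) (2 * p)), singularCohomology.π ℚ ℚ (ComplexPoints X) (2 * p) ζ = B.isoObj X (2 * p) t → (∀ σ : SingularSimplex (ComplexPoints X) (2 * p), (singularCochainComplex.iCocycles ℂ ℂ (ComplexPoints X) (2 * p) z) σ = (((singularCochainComplex.iCocycles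 ℚ ℚ (ComplexPoints X) (2 * p) ζ) σ : ℚ) : ℂ)) → (t ∈ (B.hodge hX (2 * p)).hodgeClasses (p : ℤ) ↔ IsOfHodgeType n X (2 * p) p p (singularCohomology.π ℂ ℂ (ComplexPoints X) (2 * p) z))) ∧ Submodule.span ℂ {c | ∃ t ∈ B.W.algebraicClasses X p, ∃ (ζ : singularCochainComplex.cocycles ℚ ℚ (ComplexPoints X) (2 * p)) (z : singularCochainComplex.cocycles ℂ ℂ (ComplexPoints X) (2 * p)), singularCohomology.π ℚ ℚ (ComplexPoints X) (2 * p) ζ = B.isoObj X (2 * p) t ∧ (∀ σ : SingularSimplex (ComplexPoints X) (2 * p), (singularCochainComplex.iCocycles ℂ ℂ (ComplexPoints X) (2 * p) z) σ = (((singularCochainComplex.iCocycles ℚ ℚ (ComplexPoints X) (2 * p) ζ) σ : ℚ) : ℂ)) ∧ c = singularCohomology.π ℂ ℂ (ComplexPoints X) (2 * p) z} = algebraicClasses X p ∧ Nonempty (HodgeModel n X)) → ∀ ⦃d : ℕ⦄ ⦃C Y : SchemeOver ℂ⦄ (f : Y ⟶ C) (e : C ⟶ Y), e ≫ f = 𝟙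 C → IsSmoothProjective 1 C → IsSmoothProjective (d + 1) Y → IsSmoothProjectiveFamily f d → (∀ s : AlgPoints C ℂ, ∃ A : AbelianVariety ℂ, Nonempty (A.X ≅ fiberOver f s)) → ∀ η : B.W.obj Y 2, B.W.IsHyperplaneClass Y η → ∀ (i r j : ℕ), i + r = d + 1 → ∀ h₂ : i + 2 * r = j, ∃ θ : B.W.obj Y j →ₗ[ℚ] B.W.obj Y i, B.W.IsLefschetzTheta (d + 1) η r h₂ θ ∧ B.W.IsAlgebraicOperator (d + 1) (d + 1) θ

-- earlier AbelianPencilKunnethC (stmt-HodgeConjecture-9723, replaced 2026-08-15T16:16:02Z -> stmt-HodgeConjecture-10449): retired by None — open Literature.AlgebraicGeometry.Motives CategoryTheory in ∀ B : BettiHodgeData ℂ, B.IsSummitCompatible → ∀ ⦃d : ℕ⦄ ⦃C Y : SchemeOver ℂ⦄ (f : Y ⟶ C) (e : C ⟶ Y), e ≫ f = 𝟙 C → IsSmoothProjective 1 C → IsSmoothProjective (d + 1) Y → IsSmoothProjectiveFamily f d 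
/-- item stmt-HodgeConjecture-10449 · crux · rank 5 · open · by planner
why it might fail: C(X) open over ℂ, dim≥3 (Kahn2020 §6.1). The projector onto H⁰(C,R^i) is an algebraic-operator image of Tankeev's canonical Hodge cycle in H⁰(C,R^i)⊗H⁰(C,R^i), whose algebraicity already gives B(X) (Tankeev2003): for Weil/CM pencils C(Y) ≈ as hard as B(Y)⟺HC(AV); known if invariants divisor-spanned
sources: Kleiman1968, Kahn2020, Tankeev2003, Tankeev2008, DeningerMurre1991, Milne1999LefschetzClasses
[crux] the Künneth standard conjecture C(Y) (Kleiman) for the same total spaces Y and every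
summit-compatible Betti–Hodge datum B (guard = `BettiHodgeData.IsSummitCompatible` written out over
fact-free modules: (a) t ∈ H²ᵖ_B(X) is B-Hodge iff [ζ ⊗ 1] is a rational (p,p)-class whenever [ζ] =
isoObj t, the complexified cocycle z = ζ ⊗ 1 being described by ∀ σ, z σ = ↑(ζ σ) instead of
`cocycleOfRat`; (b) complexified B-algebraic classes span Nᵖ H²ᵖ(X(ℂ);ℂ); (c) Hodge models exist —
equivalent to `B.IsSummitCompatible` by `iCocycles_cocycleOfRat`, certified in evidence
EquivTest.lean `guard_iff`): every Künneth (degree) projector of Y is an algebraic graded operator —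
VERBATIM `B.W.StandardConjectureC (d + 1) Y` unfolded (`Iff.rfl`). It is the cohomological shadow of
the informal crux ChowKunnethAbelianPencils (CK(Y) ⇒ C(Y)) and is implied by AbelianPencilLefschetzB
(B ⇒ C, tree theorem; refuter evidence W20b.lean on the rev-1 item); with Deninger–Murre's relative
projectors it isolates the projector P_{0,j} onto the Leray piece H⁰(C, R^j f_*ℚ), the first place
an exceptional class can appear — the route's early-warning item, to be attacked directly. rev 2
(cone repair): restated defin -/
@[route_item "route-HodgeConjecture-ConservativityLefschetz"]
def AbelianPencilKunnethC : Prop :=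
  open Literature.AlgebraicGeometry.Motives Literature.AlgebraicGeometry.HodgeTheory Literature.AlgebraicTopology.SingularHomology CategoryTheory in ∀ B : BettiHodgeData ℂ, (∀ ⦃n : ℕ⦄ ⦃X : SchemeOver ℂ⦄ (hX : IsSmoothProjective n X) (p : ℕ), (∀ (t : B.W.obj X (2 * p)) (ζ : singularCochainComplex.cocycles ℚ ℚ (ComplexPoints X) (2 * p)) (z : singularCochainComplex.cocycles ℂ ℂ (ComplexPoints X) (2 * p)), singularCohomology.π ℚ ℚ (ComplexPoints X) (2 * p) ζ = B.isoObj X (2 * p) t → (∀ σ : SingularSimplex (ComplexPoints X) (2 * p), (singularCochainComplex.iCocycles ℂ ℂ (ComplexPoints X) (2 * p) z) σ = (((singularCochainComplex.iCocycles ℚ ℚ (ComplexPoints X) (2 * p) ζ) σ : ℚ) : ℂ)) → (t ∈ (B.hodge hX (2 * p)).hodgeClasses (p : ℤ) ↔ IsOfHodgeType n X (2 * p) p p (singularCohomology.π ℂ ℂ (ComplexPoints X) (2 * p) z))) ∧ Submodule.span ℂ {c | ∃ t ∈ B.W.algebraicClasses X p, ∃ (ζ : singularCochainComplex.cocycles ℚ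 ℚ (ComplexPoints X) (2 * p)) (z : singularCochainComplex.cocycles ℂ ℂ (ComplexPoints X) (2 * p)), singularCohomology.π ℚ ℚ (ComplexPoints X) (2 * p) ζ = B.isoObj X (2 * p) t ∧ (∀ σ : SingularSimplex (ComplexPoints X) (2 * p), (singularCochainComplex.iCocycles ℂ ℂ (ComplexPoints X) (2 * p) z) σ = (((singularCochainComplex.iCocycles ℚ ℚ (ComplexPoints X) (2 * p) ζ) σ : ℚ) : ℂ)) ∧ c = singularCohomology.π ℂ ℂ (ComplexPoints X) (2 * p) z} = algebraicClasses X p ∧ Nonempty (HodgeModel n X)) → ∀ ⦃d : ℕ⦄ ⦃C Y : SchemeOver ℂ⦄ (f : Y ⟶ C) (e : C ⟶ Y), e ≫ f = 𝟙 C → IsSmoothProjective 1 C → IsSmoothProjective (d + 1) Y → IsSmoothProjectiveFamily f d → (∀ s : AlgPoints C ℂ, ∃ A : AbelianVariety ℂ, Nonempty (A.X ≅ fiberOver f s)) → ∀ i : ℕ, ∃ P : B.W.GradedOp Y Y, B.W.IsDegreeProjector Y i P ∧ B.W.IsAlgebraicGradedOp (d + 1) (d + 1) P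

-- earlier AndreAbelianReduction (stmt-HodgeConjecture-9724, replaced 2026-08-15T16:16:02Z -> stmt-HodgeConjecture-10450): retired by None — open Literature.AlgebraicGeometry.Motives CategoryTheory in ∀ B : BettiHodgeData ℂ, B.IsSummitCompatible → (∀ ⦃d : ℕ⦄ ⦃C Y : SchemeOver ℂ⦄ (f : Y ⟶ C) (e : C ⟶ Y), e ≫ f = 𝟙 C → IsSmoothProjective 1 C → IsSmoothProjective (d + 1) Y → IsSmoothProjectiveFamily f d
/-- item stmt-HodgeConjecture-10450 · support · rank 9 · open · by planner
sources: Andre1996Motifs, Kleiman1968, Tankeev2003, Deligne2000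
[support] André's Remarque 2 in typed form, at any summit-compatible Betti–Hodge datum B (guard =
`BettiHodgeData.IsSummitCompatible` written out over fact-free modules: (a) t ∈ H²ᵖ_B(X) is B-Hodge
iff [ζ ⊗ 1] is a rational (p,p)-class whenever [ζ] = isoObj t, the complexified cocycle z = ζ ⊗ 1
being described by ∀ σ, z σ = ↑(ζ σ) instead of `cocycleOfRat`; (b) complexified B-algebraic classes
span Nᵖ H²ᵖ(X(ℂ);ℂ); (c) Hodge models exist — equivalent to `B.IsSummitCompatible` by
`iCocycles_cocycleOfRat`, certified in evidence EquivTest.lean `guard_iff`): if B(Y) (θ-form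
unfolded exactly as in AbelianPencilLefschetzB, all hyperplane classes) holds for every compact
pencil of abelian varieties with section as above, then the B-relative Hodge conjecture ℚ·Aᵖ(A) =
Hdgᵖ(A) (`B.HodgeConjectureFor hA p`) holds for every complex abelian variety A with hA :
IsSmoothProjective A.dim A.X and every p. Printed proof: Andre1996Motifs Thm 0.6.2 (every Hodge
class on A is p_*(α ∪ ⋆_L β) with α, β algebraic on A × B × Y₁ × ⋯ × Y_k, Y_j pencils from Lemme
6.3.1, which are abelian schemes with zero section over complete curves) + §0.3 (motivated =
algebraic once ⋆_L is algebraic) + B stable under prod -/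
@[route_item "route-HodgeConjecture-ConservativityLefschetz", crux]
def AndreAbelianReduction : Prop :=
  open Literature.AlgebraicGeometry.Motives Literature.AlgebraicGeometry.HodgeTheory Literature.AlgebraicTopology.SingularHomology CategoryTheory in ∀ B : BettiHodgeData ℂ, (∀ ⦃n : ℕ⦄ ⦃X : SchemeOver ℂ⦄ (hX : IsSmoothProjective n X) (p : ℕ), (∀ (t : B.W.obj X (2 * p)) (ζ : singularCochainComplex.cocycles ℚ ℚ (ComplexPoints X) (2 * p)) (z : singularCochainComplex.cocycles ℂ ℂ (ComplexPoints X) (2 * p)), singularCohomology.π ℚ ℚ (ComplexPoints X) (2 * p) ζ = B.isoObj X (2 * p) t → (∀ σ : SingularSimplex (ComplexPoints X) (2 * p), (singularCochainComplex.iCocycles ℂ ℂ (ComplexPoints X) (2 * p) z) σ = (((singularCochainComplex.iCocycles ℚ ℚ (ComplexPoints X) (2 * p) ζ) σ : ℚ) : ℂ)) → (t ∈ (B.hodge hX (2 * p)).hodgeClasses (p : ℤ) ↔ IsOfHodgeType n X (2 * p) p p (singularCohomology.π ℂ ℂ (ComplexPoints X) (2 * p) z))) ∧ Submodule.span ℂ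 {c | ∃ t ∈ B.W.algebraicClasses X p, ∃ (ζ : singularCochainComplex.cocycles ℚ ℚ (ComplexPoints X) (2 * p)) (z : singularCochainComplex.cocycles ℂ ℂ (ComplexPoints X) (2 * p)), singularCohomology.π ℚ ℚ (ComplexPoints X) (2 * p) ζ = B.isoObj X (2 * p) t ∧ (∀ σ : SingularSimplex (ComplexPoints X) (2 * p), (singularCochainComplex.iCocycles ℂ ℂ (ComplexPoints X) (2 * p) z) σ = (((singularCochainComplex.iCocycles ℚ ℚ (ComplexPoints X) (2 * p) ζ) σ : ℚ) : ℂ)) ∧ c = singularCohomology.π ℂ ℂ (ComplexPoints X) (2 * p) z} = algebraicClasses X p ∧ Nonempty (HodgeModel n X)) → (∀ ⦃d : ℕ⦄ ⦃C Y : SchemeOver ℂ⦄ (f : Y ⟶ C) (e : C ⟶ Y), e ≫ f = 𝟙 C → IsSmoothProjective 1 C → IsSmoothProjective (d + 1) Y → IsSmoothProjectiveFamily f d → (∀ s : AlgPoints C ℂ, ∃ A : AbelianVariety ℂ, Nonempty (A.X ≅ fiberOver f s)) → ∀ η : B.W.obj Y 2, B.W.IsHyperplaneClass Y η → ∀ (i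 r j : ℕ), i + r = d + 1 → ∀ h₂ : i + 2 * r = j, ∃ θ : B.W.obj Y j →ₗ[ℚ] B.W.obj Y i, B.W.IsLefschetzTheta (d + 1) η r h₂ θ ∧ B.W.IsAlgebraicOperator (d + 1) (d + 1) θ) → ∀ (A : AbelianVariety ℂ) (hA : IsSmoothProjective A.dim A.X) (p : ℕ), B.HodgeConjectureFor hA p

-- earlier ClassicalBettiDatum (stmt-HodgeConjecture-9725, replaced 2026-08-15T16:16:02Z -> stmt-HodgeConjecture-10451): retired by None — ∃ B : Literature.AlgebraicGeometry.Motives.BettiHodgeData ℂ, B.IsSummitCompatible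
/-- item stmt-HodgeConjecture-10451 · support · rank 9 · open · by planner
sources: Deligne2000, VoisinHodgeI2002, Kleiman1968, Fulton1998
[support] CONSTRUCTION (interface/instance separation): there is a Betti–Hodge datum B :
BettiHodgeData ℂ — singular cohomology of X(ℂ) with ℚ-coefficients as a Weil cohomology, the
Hodge–Deligne Hodge structures, the topological cycle class — that (i) is summit-compatible (the
guard of the cruxes, = `BettiHodgeData.IsSummitCompatible` written out over fact-free modules, see
AbelianPencilLefschetzB; bridge `guard_iff` in evidence EquivTest.lean) and (ii) transfers: for X
smooth projective of dimension n, (∀ p, B.HodgeConjectureFor hX p) → HodgeTheory.HodgeConjectureFor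
n X. Conjunct (ii) follows from (i) by the PROVED tree theorem
`BettiHodgeData.IsSummitCompatible.hodgeConjectureFor` (Motives/BettiRealizationSummitCompatible);
it is carried here (rev 2, cone repair) so that the deciding theorem needs no import whose cone
holds unproved facts. Shared in substance with MomentAmplification's BettiBridge and PeriodsPolice's
ClassicalBridge. [difficulty: XL] -/
@[route_item "route-HodgeConjecture-ConservativityLefschetz", crux]
def ClassicalBettiDatum : Prop :=
  open Literature.AlgebraicGeometry.Motives Literature.AlgebraicGeometry.HodgeTheory Literature.AlgebraicTopology.SingularHomology CategoryTheory in ∃ B : BettiHodgeData ℂ, (∀ ⦃n : ℕ⦄ ⦃X : SchemeOver ℂ⦄ (hX : IsSmoothProjective n X) (p : ℕ), (∀ (t : B.W.obj X (2 * p)) (ζ : singularCochainComplex.cocycles ℚ ℚ (ComplexPoints X) (2 * p)) (z : singularCochainComplex.cocycles ℂ ℂ (ComplexPoints X) (2 * p)), singularCohomology.π ℚ ℚ (ComplexPoints X) (2 * p) ζ = B.isoObj X (2 * p) t → (∀ σ : SingularSimplex (ComplexPoints X) (2 * p), (singularCochainComplex.iCocycles ℂ ℂ (ComplexPoints X) (2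 * p) z) σ = (((singularCochainComplex.iCocycles ℚ ℚ (ComplexPoints X) (2 * p) ζ) σ : ℚ) : ℂ)) → (t ∈ (B.hodge hX (2 * p)).hodgeClasses (p : ℤ) ↔ IsOfHodgeType n X (2 * p) p p (singularCohomology.π ℂ ℂ (ComplexPoints X) (2 * p) z))) ∧ Submodule.span ℂ {c | ∃ t ∈ B.W.algebraicClasses X p, ∃ (ζ : singularCochainComplex.cocycles ℚ ℚ (ComplexPoints X) (2 * p)) (z : singularCochainComplex.cocycles ℂ ℂ (ComplexPoints X) (2 * p)), singularCohomology.π ℚ ℚ (ComplexPoints X) (2 * p) ζ = B.isoObj X (2 * p) t ∧ (∀ σ : SingularSimplex (ComplexPoints X) (2 * p), (singularCochainComplex.iCocycles ℂ ℂ (ComplexPoints X) (2 * p) z) σ = (((singularCochainComplex.iCocycles ℚ ℚ (ComplexPoints X) (2 * p) ζ) σ : ℚ) : ℂ)) ∧ c = singularCohomology.π ℂ ℂ (ComplexPoints X) (2 * p) z} = algebraicClasses X p ∧ Nonempty (HodgeModel n X)) ∧ ∀ ⦃n : ℕ⦄ ⦃X : SchemeOver ℂ⦄ (hX : IsSmoothProjective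 n X), (∀ p : ℕ, B.HodgeConjectureFor hX p) → Literature.AlgebraicGeometry.HodgeTheory.HodgeConjectureFor n X

-- earlier AbelianComplement (stmt-HodgeConjecture-9726, replaced 2026-08-15T16:16:02Z -> stmt-HodgeConjecture-10452): retired by None — (∀ A : Literature.AlgebraicGeometry.Motives.AbelianVariety ℂ, Literature.AlgebraicGeometry.HodgeTheory.HodgeConjectureFor A.dim A.X) → HodgeConjecture
/-- item stmt-HodgeConjecture-10452 · support · rank 9 · open · by planner
sources: Deligne2000, Andre1996Motifs
[support] NOT CLAIMED BY THIS ROUTE — the remainder of the summit: the Hodge conjecture for all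
smooth projective complex varieties GIVEN the (summit-layer) Hodge conjecture
`HodgeTheory.HodgeConjectureFor A.dim A.X` for every complex abelian variety A that is smooth
projective of dimension A.dim (rev 2, cone repair: the hypothesis hA : IsSmoothProjective A.dim A.X
is carried explicitly; EVERY abelian variety has it — tree theorem
`AbelianVariety.isSmoothProjective_holds`, Motives/AbelianVarietyProjectiveChart — so the statement
is equivalent to the rev-1 one, but the route file no longer imports that module's fact-laden cone).
Present only so that the deciding theorem reaches `HodgeConjecture` (D-0027); under this line's own
philosophy it would further reduce, CONDITIONALLY on Cons, to Murre's Chow–Künneth conjecture for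
all X plus 'Hodge classes are motivated' (André Thm 0.4) — see Two-layer plan. Any route proving the
summit outright supersedes it. Do not staff. [difficulty: open-problem] -/
@[route_item "route-HodgeConjecture-ConservativityLefschetz", crux]
def AbelianComplement : Prop :=
  (∀ A : Literature.AlgebraicGeometry.Motives.AbelianVariety ℂ, Literature.AlgebraicGeometry.Motives.IsSmoothProjective A.dim A.X → Literature.AlgebraicGeometry.HodgeTheory.HodgeConjectureFor A.dim A.X) → HodgeConjecture

-- item stmt-HodgeConjecture-9785 · support · rank 9 · open · by planner — informal only, no Lean statement yet:
--   [support] CAYLEY–HAMILTON LEMMA, the glue of the foreseen split ConservativityChow →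
--   ChowKunnethAbelianPencils → AbelianPencilLefschetzB (card P1; template Ayoub2017Conjectures Props
--   2.17/2.22; Kleiman1968 §2 θ-form): let Y be smooth projective of dimension n over ℂ with a
--   Chow–Künneth decomposition (π_i) and a hyperplane class η, and assume conservativity for morphisms
--   of Chow motives in the thick tensor subcategory ⟨h(Y)⟩ ⊂ CHM(ℂ)_ℚ. Then B(Y) holds (θ-form, for the
--   classical Betti theory): for each i ≤ n put f_i := π_{2n−i} ∘ Γ(L^{n−i}) ∘ π_i : (Y, π_i, 0) → (Y,
--   π_{2n−i}, n−i), Γ(L^{n−i}) t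

/-- item stmt-HodgeConjecture-9727 · assembly · rank 1 · closed · proved by Summit.HodgeConjecture.HodgeConjecture.Theorems.conservativityLefschetz_assembly_proof @ 56db29b4b4db (prover) · by planner
sources: Andre1996Motifs, Ayoub2017Conjectures
[assembly] AbelianPencilLefschetzB → AndreAbelianReduction → ClassicalBettiDatum → AbelianComplement
→ HodgeConjecture. -/
@[route_item "route-HodgeConjecture-ConservativityLefschetz"]
def Assembly : Prop :=
  AbelianPencilLefschetzB → AndreAbelianReduction → ClassicalBettiDatum → AbelianComplement → HodgeConjecture

/-! D-0027 §2.1 — DECIDING THEOREM (planner-authored via `route open/edit --closes-file`; by planner-rrepair-HodgeConjecture-Conservativity-a269f9da-g2-0 2026-08-15T16:16:02Z):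
its hypotheses are this route's items and its conclusion the sub-problem Statement (glue_lint), and it elaborates with this file. -/

@[closes "route-HodgeConjecture-ConservativityLefschetz"] theorem closes (h₁ : AbelianPencilLefschetzB) (h₂ : AndreAbelianReduction) (h₃ : ClassicalBettiDatum)
    (h₄ : AbelianComplement) : HodgeConjecture := by
  obtain ⟨B, hc, htr⟩ := h₃
  exact h₄ fun A hA ↦ htr hA (h₂ B hc (h₁ B hc) A hA)

end Summit.HodgeConjecture.HodgeConjecture.Theses.ConservativityLefschetz
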